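import Literature.MathematicalPhysics.QuantumLattice.DWaveSource
import HarnessLib

/-!
# The symmetrised Hubbard interaction is a chemical-potential shift by `U/2`

Topic `Literature/MathematicalPhysics/QuantumLattice`.  The on-site interaction of the Hubbard model
is written in two conventions in the literature: the plain form `U Σ_x n_{x↑} n_{x↓}` (Lieb 1989,
Tasaki 2020 §10.1; the tree's `hamiltonian`, `hubbardTorusWith`, `dWaveSourceTorus`) and the
particle–hole symmetrised form `U Σ_x (n_{x↑} - ½)(n_{x↓} - ½)` (Lieb 1994, eq. (2), the tree's
`peierlsHubbard`; Giuliani–Mastropietro 2010, eq. (1.1)).  Since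
`(n↑ - ½)(n↓ - ½) = n↑ n↓ - ½ (n↑ + n↓) + ¼`, the two grand-canonical Hamiltonians differ by a
shift of the chemical potential by `U/2` and an additive constant:

  `H(t, U) - (μ + U/2) N = H(t, 0) + U Σ_x (n_{x↑} - ½)(n_{x↓} - ½) - μ N - (U |Λ| / 4) · 1`.

This is the dictionary needed whenever a result stated for the symmetrised model (e.g. the
Grassmann functional-integral representation with the plain quartic vertex and a symmetric
Matsubara cutoff, Giuliani–Mastropietro 2010, (2.6): "the correct choice of the interaction
expressed in Grassmann variables does not include terms bilinear in the fields, contrary to the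
interaction in second quantized form") is to be read for the tree's plain-interaction operators.

## Main statements (all proved)

* `numberOp_sub_half_mul_numberOp_sub_half`, `sum_numberOp_sub_half_mul` —
  `Σ_x (n_{x↑} - ½)(n_{x↓} - ½) = Σ_x n_{x↑}n_{x↓} - ½ N + (|Λ|/4)·1`.
* `hamiltonianWith_add_half_mul_coupling` — the displayed identity on any finite graph.
* `hubbardTorusWith_add_half_mul_coupling` — the same on the torus `(ℤ/Lℤ)²` (`|Λ| = L²`).
* `dWaveSourceTorus_add_half_mul_coupling` — the same for the `d`-wave–seeded torus Hamiltonian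
  `dWaveSourceTorus L U (μ + U/2) h`: it is the seeded SYMMETRISED model at chemical potential `μ`
  minus the constant `U L²/4`.

## Sources

E. H. Lieb, *Two theorems on the Hubbard model*, PRL 62 (1989) 1201 (plain form, `- μN`);
E. H. Lieb, *Flux phase of the half-filled band*, PRL 73 (1994) 2158, eq. (2) (symmetrised form
"with the chemical potential of the half-filled band built in"); A. Giuliani, V. Mastropietro,
Commun. Math. Phys. 293 (2010) 301, eq. (1.1) and the remark after (2.6) [`GiulianiMastropietro2009`];
H. Tasaki, *Physics and Mathematics of Quantum Many-Body Systems* (2020), §10.1 [`Tasaki2020`].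
The identity itself is elementary algebra (folklore).

## What is NOT here

No statement about Grassmann integrals or their `M → ∞` limit (the functional-integral identity
is not asserted anywhere in the tree); no spectral statement.  Only the operator identity.
-/

noncomputable section

namespace Literature.MathematicalPhysics.QuantumLattice

open Matrix Finset HubbardWave0
open scoped ComplexOrder

section General

variable {Λ : Type*} [LinearOrder Λ] [Fintype Λ] (G : SimpleGraph Λ) [DecidableRel G.Adj]

omit [Fintype Λ] in
/-- One site: `(n↑ - ½)(n↓ - ½) = n↑ n↓ - ½ n↑ - ½ n↓ + ¼` in the operator algebra. [folklore] -/
theorem numberOp_sub_half_mul_numberOp_sub_half [Fintype Λ] (x : Λ) :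
    (numberOp x 0 - (1 / 2 : ℂ) • (1 : Matrix (Finset (Orb Λ)) (Finset (Orb Λ)) ℂ)) *
        (numberOp x 1 - (1 / 2 : ℂ) • 1) =
      numberOp x 0 * numberOp x 1 - (1 / 2 : ℂ) • numberOp x 0 - (1 / 2 : ℂ) • numberOp x 1 +
        (1 / 4 : ℂ) • 1 := by
  simp only [sub_mul, mul_sub, smul_sub, mul_smul_comm, smul_mul_assoc, mul_one, one_mul, smul_smul]
  module

/-- **Summed over the lattice**: `Σ_x (n_{x↑} - ½)(n_{x↓} - ½) = Σ_x n_{x↑} n_{x↓} - ½ N + (|Λ|/4) · 1`,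
`N = totalNumber`. [folklore] -/
theorem sum_numberOp_sub_half_mul :
    ∑ x : Λ, (numberOp x 0 - (1 / 2 : ℂ) • (1 : Matrix (Finset (Orb Λ)) (Finset (Orb Λ)) ℂ)) *
        (numberOp x 1 - (1 / 2 : ℂ) • 1) =
      ∑ x : Λ, numberOp x 0 * numberOp x 1 - (1 / 2 : ℂ) • totalNumber +
        ((Fintype.card Λ : ℂ) / 4) • (1 : Matrix (Finset (Orb Λ)) (Finset (Orb Λ)) ℂ) := by
  simp only [numberOp_sub_half_mul_numberOp_sub_half, Finset.sum_add_distrib, Finset.sum_sub_distrib,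
    ← Finset.smul_sum, Finset.sum_const, Finset.card_univ, totalNumber, Fin.sum_univ_two, smul_add]
  rw [← Nat.cast_smul_eq_nsmul ℂ, smul_smul]
  have : (1 / 4 : ℂ) * (Fintype.card Λ : ℂ) = (Fintype.card Λ : ℂ) / 4 := by ring
  rw [this]
  abel

/-- **The symmetrised interaction is a chemical-potential shift by `U/2`.**  On any finite graph,
`H(t, U) - (μ + U/2) N = H(t, 0) + U Σ_x (n_{x↑} - ½)(n_{x↓} - ½) - μ N - (U|Λ|/4) · 1`: the
grand-canonical Hubbard Hamiltonian with the PLAIN interaction at chemical potential `μ + U/2` is the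
one with the particle–hole SYMMETRISED interaction (Lieb 1994, eq. (2); Giuliani–Mastropietro 2010,
eq. (1.1)) at chemical potential `μ`, up to an additive constant.
[cite: GiulianiMastropietro2009, eq. (1.1) and remark after (2.6)] -/
theorem hamiltonianWith_add_half_mul_coupling (t U μ : ℝ) :
    hamiltonianWith G t U (μ + U / 2) =
      hamiltonian G t 0 +
          (U : ℂ) • ∑ x : Λ, (numberOp x 0 - (1 / 2 : ℂ) • (1 : Matrix (Finset (Orb Λ)) (Finset (Orb Λ)) ℂ)) *
            (numberOp x 1 - (1 / 2 : ℂ) • 1) -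
        (μ : ℂ) • totalNumber - ((U * Fintype.card Λ / 4 : ℝ) : ℂ) • (1 : Matrix (Finset (Orb Λ)) (Finset (Orb Λ)) ℂ) := by
  have hsplit : hamiltonian G t U = hamiltonian G t 0 + (U : ℂ) • ∑ x : Λ, numberOp x 0 * numberOp x 1 := by
    simp [hamiltonian]
  rw [hamiltonianWith, hsplit, sum_numberOp_sub_half_mul, smul_add, smul_sub, smul_smul, smul_smul]
  push_cast
  have h1 : ((μ : ℂ) + (U : ℂ) / 2) • (totalNumber : Matrix (Finset (Orb Λ)) (Finset (Orb Λ)) ℂ) =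
      (μ : ℂ) • totalNumber + ((U : ℂ) * (1 / 2)) • totalNumber := by
    rw [← add_smul]; ring_nf
  have h2 : ((U : ℂ) * ((Fintype.card Λ : ℂ) / 4)) = (U : ℂ) * (Fintype.card Λ : ℂ) / 4 := by ring
  rw [h1, h2]
  abel

end General

section Torus

open Literature.Probability.LatticeModels

/-- **Torus version.**  `hubbardTorusWith 2 L t U (μ + U/2) = hubbardTorus 2 L t 0 + U Σ_x (n_{x↑} - ½)(n_{x↓} - ½)
- μ N - (U L²/4) · 1` on `(ℤ/Lℤ)²`. [cite: GiulianiMastropietro2009, eq. (1.1) and remark after (2.6)] -/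
theorem hubbardTorusWith_add_half_mul_coupling (L : ℕ) (t U μ : ℝ) :
    hubbardTorusWith 2 L t U (μ + U / 2) =
      hubbardTorus 2 L t 0 +
          (U : ℂ) • ∑ x : FermionTorus 2 L,
            (numberOp x 0 - (1 / 2 : ℂ) • (1 : Matrix (Finset (Orb (FermionTorus 2 L))) (Finset (Orb (FermionTorus 2 L))) ℂ)) *
              (numberOp x 1 - (1 / 2 : ℂ) • 1) -
        (μ : ℂ) • totalNumber -
          ((U * (L : ℝ) ^ 2 / 4 : ℝ) : ℂ) • (1 : Matrix (Finset (Orb (FermionTorus 2 L))) (Finset (Orb (FermionTorus 2 L))) ℂ) := by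
  have e := hamiltonianWith_add_half_mul_coupling (fermionTorusGraph 2 L) t U μ
  rw [show Fintype.card (FermionTorus 2 L) = L ^ 2 by simp] at e
  rw [hubbardTorusWith, hubbardTorus]
  push_cast at e ⊢
  convert e

/-- **Seeded torus version (the `d`-wave source commutes with the bookkeeping).**
`dWaveSourceTorus L U (μ + U/2) h = hubbardTorus 2 L 1 0 + U Σ_x (n_{x↑} - ½)(n_{x↓} - ½) - μ N - h (Δ_d + Δ_d†)
- (U L²/4) · 1`: the tree's seeded grand-canonical Hubbard torus with the PLAIN interaction at
chemical potential `μ + U/2` is the seeded SYMMETRISED model (the operator model whose normalised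
partition function the symmetric-Matsubara-cutoff Grassmann integral with the plain quartic vertex
represents, Giuliani–Mastropietro 2010 (1.1)/(2.6)) at chemical potential `μ`, minus the constant
`U L²/4` (which drops out of every Gibbs / ground-state expectation).
[cite: GiulianiMastropietro2009, eq. (1.1) and remark after (2.6)] -/
theorem dWaveSourceTorus_add_half_mul_coupling (L : ℕ) [NeZero L] (U μ h : ℝ) :
    dWaveSourceTorus L U (μ + U / 2) h =
      hubbardTorus 2 L 1 0 +
            (U : ℂ) • ∑ x : FermionTorus 2 L,
              (numberOp x 0 - (1 / 2 : ℂ) • (1 : Matrix (Finset (Orb (FermionTorus 2 L))) (Finset (Orb (FermionTorus 2 L))) ℂ)) *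
                (numberOp x 1 - (1 / 2 : ℂ) • 1) -
          (μ : ℂ) • totalNumber -
          (h : ℂ) • (pairField dWaveFormFactor L + (pairField dWaveFormFactor L)ᴴ) -
        ((U * (L : ℝ) ^ 2 / 4 : ℝ) : ℂ) • (1 : Matrix (Finset (Orb (FermionTorus 2 L))) (Finset (Orb (FermionTorus 2 L))) ℂ) := by
  rw [dWaveSourceTorus, hubbardTorusWith_add_half_mul_coupling]
  abel

end Torus

end Literature.MathematicalPhysics.QuantumLattice
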